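import Summits.QuantumFields.BalabanUV.T4Continuum.Support.NE3QbarIterMajorant
import Summits.QuantumFields.BalabanUV.T4Continuum.Support.NE7FlatSliceSourceDuality
import Summits.QuantumFields.BalabanUV.T4Continuum.Support.AveragingDeficitTorusChart
import HarnessLib

/-!
# NE7PeriodicBlockSums — periodic `L¹` bookkeeping for block sums: `Σ_{z ∈ periodBox P} Σ_{r ∈ [0,L)^d} f(L•z + r + u) ≤ Σ_{periodBox (PL)} f`
# for periodic `f ≥ 0`, and the word-weight corollary `Σ_z lsum ω (L•z + u) Γ ≤ |Γ|·‖ω‖_{L¹(period)}`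

Cell `pub-balaban`, rung (B)+1 sub-cell t4, lineage `b2b-balaban-t4-ne7-p1`, generation 74 (CRUX PROVER NE7 #1, OWNER row NE7).  Memo `REP-FLAT-ROAD-v4.md` §4.
WHY.  R2∕R4 (`NE7CriticalTensionLetter`, `NE7CovDivB8Letter`) carry the (160) hypothesis `Σ_{z ∈ periodBox N} Σ_κ ‖QbarIter L (k+1) U Y z κ − QbarIter L (k+1) ♭ Y z κ‖
≤ Λ·dirL1 Y (periodBox (N·L^{k+1}))`.  It is discharged (next file, `NE7MajorantL1`) by the `L¹(period box) → L¹(period box)` norm of the POSITIVE majorant tower of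
`NE3QbarIterMajorant` — which needs exactly the two counting facts of this file: blocks of the coarse period box tile the fine period box (injectively modulo the
period), and a word of length `ℓ` read at every coarse corner weighs at most `ℓ` copies of the period's `L¹` mass.

WHAT ([folklore]; 0 def, 0 sorry; every dimension `d`).
§1 `lsum_add_period` (periodic weights have periodic word weights; `lsum` of a segment is `NE3MajorantProfile.lsum_seg_eq_sum`, BY NAME there).
§2 **`sum_periodBox_block_shift_le`**: for `f ≥ 0` `(PL)`-periodic and any shift `u`, `Σ_{z ∈ periodBox P} Σ_{r : [0,L)^d} f(L•z + boxVec r + u) ≤ Σ_{y ∈ periodBox (PL)} f y`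
   (the map `(z, r) ↦ (L•z + r + u) mod PL` is injective on `periodBox P × [0,L)^d`); `sum_periodBox_shift_le` (the `r = 0` slice).
§3 **`sum_periodBox_lsum_le`**: for a bond weight `ω ≥ 0`, `(PL)`-periodic, every word `Γ` and shift `u`:
   `Σ_{z ∈ periodBox P} lsum ω (L•z + u) Γ ≤ |Γ|·Σ_{y ∈ periodBox (PL)} Σ_μ ω(y, μ)`.

HONEST FRAMING (page 1): lattice bookkeeping; nothing about minimisers or gauges; REP♭∕(APE)∕NE7 NOT proved here; spine 0∕9; finite T⁴ rung (B)+1 — NOT infinite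
volume, NOT mass gap, NOT Clay.  Continuum YM on T⁴ ⇐ BetaPertH ∧ nine spine estimates (0/9 proved); BetaPertH ⇐ (D1) ∧ (D4) ∧ CAP+tail.
-/

set_option autoImplicit false

open scoped BigOperators
open Finset

namespace Summit.QuantumFields.BalabanUV.T4Continuum.NE7PeriodicBlockSums

open Literature.MathematicalPhysics.QuantumFieldTheory.Balaban1983to89
open B7Prop1Explicit
open T4AveragingDeficitWallBoundary (periodBox mem_periodBox)
open AveragingDeficitTorusChart (redN coe_redN boxVec_redN eq_wrap_add periodic_smul_vec)
open NE3QbarIterMajorant (lsum lsum_nil lsum_cons)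
open NE7FlatSliceSourceDuality (sum_periodBox_eq_sum_boxVec)

noncomputable section

variable {d : ℕ}

/-! ## §1 Word weights: periodicity -/

/-- A `Q`-periodic bond weight has `Q`-periodic word weights. [folklore] -/
theorem lsum_add_period {ω : Site d → Fin d → ℝ} {Q : ℤ} (hω : ∀ (y : Site d) (i : Fin d) (μ : Fin d), ω (y + Q • e i) μ = ω y μ) (i : Fin d) :
    ∀ (w : List (Letter d)) (x : Site d), lsum ω (x + Q • e i) w = lsum ω x w
  | [], x => by simp
  | l :: w, x => by
    rw [lsum_cons, lsum_cons, show x + Q • e i + l.vec = (x + l.vec) + Q • e i by abel, lsum_add_period hω i w (x + l.vec)]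
    congr 1
    split_ifs
    · exact hω x i l.1
    · exact hω (x + l.vec) i l.1

/-! ## §2 Blocks of the coarse period box tile the fine period box, injectively modulo the period -/

/-- Arithmetic core: `L·s + r = L·s′ + r′` with `r, r′ ∈ [0, L)` forces `s = s′`, `r = r′`. [folklore] -/
theorem block_coords_eq {L : ℤ} (hL : 0 < L) {s s' r r' : ℤ} (hr : 0 ≤ r) (hrL : r < L) (hr' : 0 ≤ r') (hr'L : r' < L)
    (h : L * s + r = L * s' + r') : s = s' ∧ r = r' := by
  have hmod : r % L = r' % L := by
    have h1 : (r + L * s) % L = (r' + L * s') % L := by rw [add_comm r, add_comm r', h]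
    rwa [Int.add_mul_emod_self_left, Int.add_mul_emod_self_left] at h1
  rw [Int.emod_eq_of_lt hr hrL, Int.emod_eq_of_lt hr' hr'L] at hmod
  subst hmod
  refine ⟨?_, rfl⟩
  have h2 : L * s = L * s' := by linarith
  exact mul_left_cancel₀ hL.ne' h2

/-- **BLOCK TILING OF THE PERIOD BOX**: for `f ≥ 0` periodic with period `PL` and any shift `u`,
`Σ_{z ∈ periodBox P} Σ_{r ∈ [0,L)^d} f(L•z + boxVec r + u) ≤ Σ_{y ∈ periodBox (PL)} f y`. [folklore] -/
theorem sum_periodBox_block_shift_le {P L : ℕ} [NeZero P] (hL : 1 ≤ L) {f : Site d → ℝ} (hf0 : ∀ y, 0 ≤ f y)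
    (hfP : ∀ (y : Site d) (i : Fin d), f (y + ((P * L : ℕ) : ℤ) • e i) = f y) (u : Site d) :
    ∑ z ∈ periodBox (d := d) P, ∑ r : Fin d → Fin L, f ((L : ℤ) • z + boxVec L r + u) ≤ ∑ y ∈ periodBox (d := d) (P * L), f y := by
  classical
  haveI : NeZero (P * L) := ⟨Nat.mul_ne_zero (NeZero.ne P) (by omega)⟩
  have hLz : (0 : ℤ) < L := by exact_mod_cast hL
  have hPLz : (0 : ℤ) < ((P * L : ℕ) : ℤ) := by exact_mod_cast Nat.pos_of_ne_zero (NeZero.ne (P * L))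
  -- wrap into the period box
  have hwrap : ∀ y : Site d, f y = f (boxVec (P * L) (redN (P * L) y)) := fun y => by
    conv_lhs => rw [eq_wrap_add (P * L) y]
    exact periodic_smul_vec hfP _ _
  -- the map `(s, r) ↦ (L•boxVec s + boxVec r + u) mod PL` is injective
  set φ : (Fin d → Fin P) × (Fin d → Fin L) → (Fin d → Fin (P * L)) :=
    fun p => redN (P * L) ((L : ℤ) • boxVec P p.1 + boxVec L p.2 + u) with hφ
  have hinj : Set.InjOn φ ↑((Finset.univ : Finset (Fin d → Fin P)) ×ˢ (Finset.univ : Finset (Fin d → Fin L))) := by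
    rintro ⟨s, r⟩ - ⟨s', r'⟩ - h
    have hi : ∀ i : Fin d, (s i : ℤ) = s' i ∧ ((r i : ℕ) : ℤ) = r' i := by
      intro i
      have h1 := congrArg (fun ρ : Fin d → Fin (P * L) => ((ρ i : ℕ) : ℤ)) h
      simp only [hφ, coe_redN, Pi.add_apply, Pi.smul_apply, smul_eq_mul, boxVec] at h1
      -- both `L s_i + r_i` lie in `[0, PL)`
      have hb : ∀ (a : Fin P) (b : Fin L), 0 ≤ (L : ℤ) * (a : ℕ) + (b : ℕ) ∧ (L : ℤ) * (a : ℕ) + (b : ℕ) < ((P * L : ℕ) : ℤ) := by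
        intro a b
        have ha := a.isLt
        have hb := b.isLt
        refine ⟨by positivity, ?_⟩
        have h2 : (L : ℤ) * (a : ℕ) + (b : ℕ) < (L : ℤ) * (a : ℕ) + L := by
          have : ((b : ℕ) : ℤ) < L := by exact_mod_cast hb
          linarith
        have h3 : (L : ℤ) * (a : ℕ) + L = (L : ℤ) * ((a : ℕ) + 1) := by ring
        have h4 : (L : ℤ) * ((a : ℕ) + 1) ≤ (L : ℤ) * P := by
          have : ((a : ℕ) : ℤ) + 1 ≤ P := by exact_mod_cast ha
          exact mul_le_mul_of_nonneg_left this hLz.le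
        push_cast
        linarith
      have hmod : ((L : ℤ) * (s i : ℕ) + (r i : ℕ)) % ((P * L : ℕ) : ℤ) = ((L : ℤ) * (s' i : ℕ) + (r' i : ℕ)) % ((P * L : ℕ) : ℤ) := by
        have e1 : (L : ℤ) * (s i : ℕ) + (r i : ℕ) + u i = u i + ((L : ℤ) * (s i : ℕ) + (r i : ℕ)) := by ring
        have e2 : (L : ℤ) * (s' i : ℕ) + (r' i : ℕ) + u i = u i + ((L : ℤ) * (s' i : ℕ) + (r' i : ℕ)) := by ring
        rw [e1, e2] at h1
        have h3 := Int.ModEq.add_left_cancel' (u i) h1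
        exact h3
      rw [Int.emod_eq_of_lt (hb (s i) (r i)).1 (hb (s i) (r i)).2, Int.emod_eq_of_lt (hb (s' i) (r' i)).1 (hb (s' i) (r' i)).2] at hmod
      have := block_coords_eq hLz (by positivity) (by exact_mod_cast (r i).isLt) (by positivity) (by exact_mod_cast (r' i).isLt) hmod
      exact ⟨this.1, this.2⟩
    refine Prod.ext (funext fun i => Fin.ext ?_) (funext fun i => Fin.ext ?_)
    · exact_mod_cast (hi i).1
    · exact_mod_cast (hi i).2
  -- reindex and compare
  rw [sum_periodBox_eq_sum_boxVec P, sum_periodBox_eq_sum_boxVec (P * L), ← Finset.sum_product']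
  calc ∑ p ∈ (Finset.univ : Finset (Fin d → Fin P)) ×ˢ (Finset.univ : Finset (Fin d → Fin L)),
          f ((L : ℤ) • boxVec P p.1 + boxVec L p.2 + u)
        = ∑ p ∈ (Finset.univ : Finset (Fin d → Fin P)) ×ˢ (Finset.univ : Finset (Fin d → Fin L)), f (boxVec (P * L) (φ p)) :=
          Finset.sum_congr rfl fun p _ => hwrap _
    _ = ∑ ρ ∈ ((Finset.univ : Finset (Fin d → Fin P)) ×ˢ (Finset.univ : Finset (Fin d → Fin L))).image φ, f (boxVec (P * L) ρ) :=
          (Finset.sum_image (f := fun ρ => f (boxVec (P * L) ρ)) hinj).symm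
    _ ≤ ∑ ρ : Fin d → Fin (P * L), f (boxVec (P * L) ρ) :=
          Finset.sum_le_sum_of_subset_of_nonneg (Finset.subset_univ _) fun _ _ _ => hf0 _

/-- The `r = 0` slice: `Σ_{z ∈ periodBox P} f(L•z + u) ≤ Σ_{y ∈ periodBox (PL)} f y`. [folklore] -/
theorem sum_periodBox_shift_le {P L : ℕ} [NeZero P] (hL : 1 ≤ L) {f : Site d → ℝ} (hf0 : ∀ y, 0 ≤ f y)
    (hfP : ∀ (y : Site d) (i : Fin d), f (y + ((P * L : ℕ) : ℤ) • e i) = f y) (u : Site d) :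
    ∑ z ∈ periodBox (d := d) P, f ((L : ℤ) • z + u) ≤ ∑ y ∈ periodBox (d := d) (P * L), f y := by
  haveI : NeZero L := ⟨by omega⟩
  refine le_trans (Finset.sum_le_sum fun z _ => ?_) (sum_periodBox_block_shift_le hL hf0 hfP u)
  have h0 : boxVec (d := d) L (0 : Fin d → Fin L) = 0 := by funext i; simp [boxVec]
  have h := Finset.single_le_sum (f := fun r : Fin d → Fin L => f ((L : ℤ) • z + boxVec L r + u)) (fun r _ => hf0 _)
    (Finset.mem_univ (0 : Fin d → Fin L))
  simp only [h0, add_zero] at h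
  exact h

/-! ## §3 A word read at every coarse corner weighs at most its length times the period's mass -/

/-- **WORD WEIGHTS OVER THE COARSE PERIOD BOX**: for `ω ≥ 0` periodic with period `PL`, every word `Γ` and shift `u`,
`Σ_{z ∈ periodBox P} lsum ω (L•z + u) Γ ≤ |Γ|·Σ_{y ∈ periodBox (PL)} Σ_μ ω(y, μ)`. [folklore] -/
theorem sum_periodBox_lsum_le {P L : ℕ} [NeZero P] (hL : 1 ≤ L) {ω : Site d → Fin d → ℝ} (hω0 : ∀ (y : Site d) (μ : Fin d), 0 ≤ ω y μ)
    (hωP : ∀ (y : Site d) (i : Fin d) (μ : Fin d), ω (y + ((P * L : ℕ) : ℤ) • e i) μ = ω y μ) :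
    ∀ (w : List (Letter d)) (u : Site d),
      ∑ z ∈ periodBox (d := d) P, lsum ω ((L : ℤ) • z + u) w ≤ w.length * ∑ y ∈ periodBox (d := d) (P * L), ∑ μ : Fin d, ω y μ
  | [], u => by simp
  | l :: w, u => by
    have ih := sum_periodBox_lsum_le hL hω0 hωP w (u + l.vec)
    simp only [lsum_cons, List.length_cons, Nat.cast_succ]
    rw [Finset.sum_add_distrib, add_mul, one_mul, add_comm ((w.length : ℝ) * _)]
    refine add_le_add ?_ ?_
    · have hre : ∀ z : Site d, (if l.2 then (L : ℤ) • z + u else (L : ℤ) • z + u + l.vec) = (L : ℤ) • z + (if l.2 then u else u + l.vec) := by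
        intro z; split_ifs <;> abel
      simp only [hre]
      refine (sum_periodBox_shift_le hL (f := fun y => ω y l.1) (fun y => hω0 y _) (fun y i => hωP y i _) _).trans ?_
      exact Finset.sum_le_sum fun y _ => Finset.single_le_sum (f := fun μ => ω y μ) (fun μ _ => hω0 y μ) (Finset.mem_univ l.1)
    · simp only [show ∀ z : Site d, (L : ℤ) • z + u + l.vec = (L : ℤ) • z + (u + l.vec) from fun z => add_assoc _ _ _]
      exact ih

end

end Summit.QuantumFields.BalabanUV.T4Continuum.NE7PeriodicBlockSums
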